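import Summits.Ventures.GridStability.Models.IEEE118SPd
import Summits.Ventures.GridStability.Lyapunov.StructurePreservingPolytopeRoa
import Summits.Ventures.GridStability.Lyapunov.StructurePreservingPolytopeLevel
import HarnessLib

/-!
# GridStability/Bench/IEEE118SPdPolytopeRoa — «ARCH-4 twin of Bench/IEEE118SPPolytopeRoa.lean (p653664) on Models/IEEE118SPd.lean — polytope-route region at 23/5 (edgeChecks by the linear bulk driver); (c) instrument row «CS18π-4» (SIZE INSTRUMENT — printed network + declared-synthetic machine layer (MODELLED)), no verdict»: the 172-node STRUCTURE-PRESERVING instance `Models/IEEE118SPd.lean` on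
# Vu–Turitsyn's polytope: the certified synchronisation region at the RATIONAL level `c = 23/5` (solver-free; every damping vector `D > 0`)

LADDER-GRIDFUSION G2-SCALE experiment cell (lead g19 §15 (D33) «CONTENT ROW ON AN EXISTING TREE ARCHITECTURE»: the POLYTOPE ROUTE of lyap-1 g6
— `Lyapunov/StructurePreservingPolytopeRoa.lean` `vtSublevel_subset_regionOfAttraction` + `…PolytopeLevel.ratGap_le_vtGap`; template instance
`Bench/NE39SPPolytopeRoa.lean`). GENERATED by `cert/sos-2/sp/gen_sp_bench_lean.py --route polytope` (gridfusion-sos-2) from the instance file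
`sp172.json` (sha16 `dca6c838864bcb9d`) — decls and proofs VERBATIM the template (NE39 regenerated decl-for-decl); NO NEW DATA LITERAL here: the only
numerals of this file are the level `23/5` and the window level `61/100` and Mathlib's `π < 3.141593` inside `ratGap`. INSTANCE BY NAME: `Models/IEEE118SPd.lean` (column LF
couplings `wtLFQ`, half-angle tangents `tLFQ`, `δ₀ = halfAngle t`, `P⁰ := f(δ₀)`; damping `D` a PARAMETER). MODELLED tokens = that file's header:
MV-3 + lossless + taps-kept + V-frozen(LF)|V1 + |E|′(h12) + eq=b (MV-P: P′ := pe(δ₀)) + MV-ω (ω_s = 377) + dynamic data as labelled = «SYNTHETIC — xd=0.25,H=4,S=rating» (machine layer SYNTHETIC; lit-2 MODELLED column verbatim) + D(∀, parameter). MODEL M′ network of record — network: MATPOWER 7.1 `case118.m` AS DISTRIBUTED (paper:matpower71-case118, R2-signed W-R2-1) + DECLARED-SYNTHETIC machine layer x′_d 0.25 pu / H 4 s on the rating proxy (MODELLED; acq-14091 open) — SIZE INSTRUMENT layer A, no verdict; ARCH-4 (DIRECTOR RULING 84, Q4′ «ENCODING-CURE»; lead §57 D72 / §60 D79–D80: closed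 search-tree data `Models/StructurePreservingTableTree` + genLast + linear bulk driver — the one encoding change vs arch-3) — SAME STATEMENTS as the original Bench module; Q4′ (c) kernel-time INSTRUMENT row «CS18α-4».

THREE COLUMNS. CERTIFIED (kernel, here): `edgeChecks` — for each of the 233 listed edges `e`, over `ℚ` by ONE `decide`: `t_src·t_tgt > −1`,
`0 ≤ ratGap q_e` and `23/5 < wt_e · ratGap q_e` (`q_e = (t_src − t_tgt)/(1 + t_src t_tgt)`; `ratGap q = 2(1 − q²)/(1 + q²) − (3.141593 −
4|q|/(1 + q²))·2|q|/(1 + q²) ≤ vtGap(2·arctan t_src − 2·arctan t_tgt)`); hence `level_lt_edgeGap`: `23/5 < bᵢⱼ·vtGap(δ₀ᵢ − δ₀ⱼ)` on EVERY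
coupled pair (binding edge bus 24–bus 70: `wt·ratGap ≈ 4.6986`; five smallest: 4.699 (bus 24–bus 70), 5.366 (bus 49–bus 69), 5.897 (bus 92–bus 100), 6.117 (bus 47–bus 69), 6.808 (bus 100–bus 106)); and the sentences
below. VALIDATED: not here. No SDP, no Gram matrix, no interval arithmetic; no sentence of this file says that any grid is stable. No definition
except the bookkeeping abbreviation `hqQ`; no named fact; standard axioms.
-/

noncomputable section

open Set Filter Topology Real
open Summit.Ventures.GridStability.Models
open Summit.Ventures.GridStability.Models.StructurePreserving
open Summit.Ventures.GridStability.Models.IEEE118SPd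
open Summit.Ventures.GridStability.Lyapunov.StructurePreserving
open Literature.MathematicalPhysics.PowerSystems.ClassicalModel.LosslessSystem (vtGap)

namespace Summit.Ventures.GridStability.Bench.IEEE118SPd

/-- The half-angle-tangent quotient of listed edge `e` over `ℚ` (bookkeeping for the `decide`):
`q_e = (t_src − t_tgt)/(1 + t_src·t_tgt)` on the literals `tLFQ`, `srcV`, `tgtV`. -/
def hqQ (e : Fin 233) : ℚ :=
  (IEEE118SPd.tLFQ (IEEE118SPd.srcV e) - IEEE118SPd.tLFQ (IEEE118SPd.tgtV e))
    / (1 + IEEE118SPd.tLFQ (IEEE118SPd.srcV e) * IEEE118SPd.tLFQ (IEEE118SPd.tgtV e))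

set_option maxRecDepth 200000 in
/-- **The 233 per-edge kernel checks over `ℚ` (one `decide`)**: `t_src·t_tgt > −1`, the rational gap
bound is nonnegative, and `23/5 < wt_e · ratGap q_e` (column LF). Binding edge: bus 24–bus 70 (index 48,
`wt·ratGap ≈ 4.6986`). CERTIFIED column. [cite: VuTuritsyn2016, Appendix 9.3] -/
theorem edgeChecks : ∀ e : Fin 233,
    (-1 : ℚ) < IEEE118SPd.tLFQ (IEEE118SPd.srcV e) * IEEE118SPd.tLFQ (IEEE118SPd.tgtV e) ∧
      0 ≤ ratGap (hqQ e) ∧ (23 / 5 : ℚ) < IEEE118SPd.wtLFQ e * ratGap (hqQ e) :=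
  (forall_fin_of_finRange_all_decide (P := fun e : Fin 233 =>
    (-1 : ℚ) < IEEE118SPd.tLFQ (IEEE118SPd.srcV e) * IEEE118SPd.tLFQ (IEEE118SPd.tgtV e) ∧
      0 ≤ ratGap (hqQ e) ∧ (23 / 5 : ℚ) < IEEE118SPd.wtLFQ e * ratGap (hqQ e)) (by decide +kernel))

/-- The quotient cast to `ℝ` is `hq` of the real half-angle tangents. [folklore] -/
theorem hqQ_cast (e : Fin 233) :
    ((hqQ e : ℚ) : ℝ) = hq (IEEE118SPd.t (IEEE118SPd.srcV e)) (IEEE118SPd.t (IEEE118SPd.tgtV e)) := by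
  unfold hqQ hq IEEE118SPd.t
  push_cast
  rfl

/-- **The certified per-edge level on EVERY coupled pair**: `23/5 < bᵢⱼ · vtGap(δ₀ᵢ − δ₀ⱼ)` whenever
`bᵢⱼ ≠ 0` (column LF; from `edgeChecks` through `level_of_edgeChecks` and `ratGap_le_vtGap`).
CERTIFIED column. [cite: VuTuritsyn2016, §IV (third construction) and Appendix 9.3] -/
theorem level_lt_edgeGap (D : Fin 172 → ℝ) :
    ∀ i j, (params D).b i j ≠ 0 → (23 / 5 : ℝ) < (params D).b i j * vtGap (IEEE118SPd.δ₀ i - IEEE118SPd.δ₀ j) := by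
  intro i j hij
  rw [params_b] at hij ⊢
  have hprod : ∀ e, (-1 : ℝ) < IEEE118SPd.t (IEEE118SPd.srcV e) * IEEE118SPd.t (IEEE118SPd.tgtV e) := fun e => by
    unfold IEEE118SPd.t
    exact_mod_cast (edgeChecks e).1
  have hR0 : ∀ e, 0 ≤ ratGap (hq (IEEE118SPd.t (IEEE118SPd.srcV e)) (IEEE118SPd.t (IEEE118SPd.tgtV e))) := fun e => by
    rw [← hqQ_cast, ← ratGap_ratCast]
    exact_mod_cast (edgeChecks e).2.1
  have hc : ∀ e, ((23 / 5 : ℚ) : ℝ) < IEEE118SPd.wt e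
      * ratGap (hq (IEEE118SPd.t (IEEE118SPd.srcV e)) (IEEE118SPd.t (IEEE118SPd.tgtV e))) := fun e => by
    rw [← hqQ_cast, ← ratGap_ratCast]
    unfold IEEE118SPd.wt
    exact_mod_cast (edgeChecks e).2.2
  have h := level_of_edgeChecks IEEE118SPd.wt_nonneg hprod hR0 hc hij
  have hlev : ((23 / 5 : ℚ) : ℝ) = (23 / 5 : ℝ) := by norm_num
  rw [hlev] at h
  exact h

/-- The equilibrium line angles are STRICTLY below `π/2` on coupled pairs (`θ = 2·arctan τ_max < π/2`,
the instance module's `window` and `theta_lt_pi_div_two`). [folklore] -/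
theorem window_strict (D : Fin 172 → ℝ) :
    ∀ i j, (params D).b i j ≠ 0 → |IEEE118SPd.δ₀ i - IEEE118SPd.δ₀ j| < π / 2 :=
  fun i j hij => (IEEE118SPd.window D i j hij).trans_lt IEEE118SPd.theta_lt_pi_div_two

/-- **«ARCH-4 twin of Bench/IEEE118SPPolytopeRoa.lean (p653664) on Models/IEEE118SPd.lean — polytope-route region at 23/5 (edgeChecks by the linear bulk driver); (c) instrument row «CS18π-4» (SIZE INSTRUMENT — printed network + declared-synthetic machine layer (MODELLED)), no verdict» on Vu–Turitsyn's polytope — the certified region (phase-space form), level `23/5`.**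
MODEL M′ of `Models/IEEE118SPd.lean` (column LF), for EVERY damping / load-frequency vector `D > 0`: from every phase point
`y = (δ, ω)` with every coupled line angle in the polytope `|(δᵢ − δⱼ) + (δ₀ᵢ − δ₀ⱼ)| < π`, on the momentum leaf through the
equilibrium with zero bus pseudo-frequencies, and with energy `V(δ₀; δ, ω) ≤ 23/5`, a global solution of the structure-preserving
field exists, and EVERY global solution from `y` keeps the polytope, the leaf and `V ≤ 23/5` for all `t ≥ 0` and tends to `(δ₀, 0)`.
One call of `vtSublevel_subset_regionOfAttraction` with the instance module's data facts and `level_lt_edgeGap`. No sentence here says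
a grid is stable. [cite: VuTuritsyn2016, §IV] -/
theorem polytope_roa {D : Fin 172 → ℝ} (hD : ∀ i, 0 < D i) {y : (Fin 172 → ℝ) × (Fin 172 → ℝ)}
    (hy : y ∈ vtPolytope (params D) IEEE118SPd.δ₀ ∩ constraintSet (params D) IEEE118SPd.δ₀ ∧
      phaseEnergy (params D) IEEE118SPd.δ₀ y ≤ 23 / 5) :
    (∃ X : ℝ → (Fin 172 → ℝ) × (Fin 172 → ℝ), X 0 = y ∧
      ∀ T : ℝ, ∀ s ∈ Icc 0 T, HasDerivWithinAt X (phaseField (params D) (X s)) (Icc 0 T) s) ∧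
    ∀ X : ℝ → (Fin 172 → ℝ) × (Fin 172 → ℝ), X 0 = y →
      (∀ T : ℝ, ∀ s ∈ Icc 0 T, HasDerivWithinAt X (phaseField (params D) (X s)) (Icc 0 T) s) →
      (∀ s, 0 ≤ s → X s ∈ vtPolytope (params D) IEEE118SPd.δ₀ ∩ constraintSet (params D) IEEE118SPd.δ₀ ∧
        phaseEnergy (params D) IEEE118SPd.δ₀ (X s) ≤ 23 / 5) ∧ Tendsto X atTop (𝓝 (IEEE118SPd.δ₀, 0)) :=
  vtSublevel_subset_regionOfAttraction (wellFormed hD) (by decide) (preconnected D)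
    (fun i j => by rw [params_b]; exact b_nonneg i j) (window_strict D) (isSyncEquilibrium D)
    (level_lt_edgeGap D) hy

/-- **The same in the printed second-order vocabulary**: for EVERY `D > 0` and every solution `δ` of the structure-preserving
model `params D` AS TYPED (`Params.IsSolution`; `ω₀ = 0` here because `P⁰ := f(δ₀)`) whose initial state has every coupled line angle
in the polytope `|(δᵢ(0) − δⱼ(0)) + (δ₀ᵢ − δ₀ⱼ)| < π`, momentum `L(δ(0), δ̇(0)) = L(δ₀, 0)` and energy `V(δ₀; δ(0), δ̇(0)) ≤ 23/5`:
the polytope and `V ≤ 23/5` hold for all `t ≥ 0`, every node angle converges, `δᵢ(t) → δ₀ᵢ`, and every generator frequency deviation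
tends to zero. MODEL M′; no sentence here says a grid is stable. [cite: VuTuritsyn2016, §IV; BergenHill1981] -/
theorem polytope_tendsto_of_isSolution {D : Fin 172 → ℝ} (hD : ∀ i, 0 < D i) {δ : ℝ → Fin 172 → ℝ}
    (hδ : (params D).IsSolution δ)
    (hpol : ∀ i j, (params D).b i j ≠ 0 → |(δ 0 i - δ 0 j) + (IEEE118SPd.δ₀ i - IEEE118SPd.δ₀ j)| < π)
    (hL : (params D).momentum (δ 0) (fun i => deriv (fun u => δ u i) 0)
      = (params D).momentum IEEE118SPd.δ₀ 0)
    (hV : (params D).energy IEEE118SPd.δ₀ (δ 0) (fun i => deriv (fun u => δ u i) 0) ≤ 23 / 5) :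
    (∀ t, 0 ≤ t →
        (∀ i j, (params D).b i j ≠ 0 → |(δ t i - δ t j) + (IEEE118SPd.δ₀ i - IEEE118SPd.δ₀ j)| < π) ∧
        (params D).energy IEEE118SPd.δ₀ (δ t) (fun i => deriv (fun u => δ u i) t) ≤ 23 / 5) ∧
      Tendsto δ atTop (𝓝 IEEE118SPd.δ₀) ∧
      ∀ i ∈ (params D).gen, Tendsto (fun t => deriv (fun u => δ u i) t) atTop (𝓝 0) := by
  have hs : (params D).shifted.IsSolution δ := by
    rw [(params D).shifted_eq_self_of_P0_eq_pe IEEE118SPd.b_symm (IEEE118SPd.params_P0 D)]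
    exact hδ
  exact tendsto_of_isSolution_vt (wellFormed hD) (by decide) (preconnected D)
    (fun i j => by rw [params_b]; exact b_nonneg i j) (window_strict D) (isSyncEquilibrium D)
    (level_lt_edgeGap D) hs hpol hL hV

/-- **The equilibrium itself is certified** (the region is a neighbourhood of `(δ₀, 0)` in the leaf):
`(δ₀, 0)` lies in the polytope, on the leaf, with `V = 0 ≤ 23/5`. [folklore] -/
theorem equilibrium_mem_region (D : Fin 172 → ℝ) :
    ((IEEE118SPd.δ₀, 0) : (Fin 172 → ℝ) × (Fin 172 → ℝ)) ∈
        vtPolytope (params D) IEEE118SPd.δ₀ ∩ constraintSet (params D) IEEE118SPd.δ₀ ∧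
      phaseEnergy (params D) IEEE118SPd.δ₀ ((IEEE118SPd.δ₀, 0) : (Fin 172 → ℝ) × (Fin 172 → ℝ)) ≤ 23 / 5 :=
  equilibrium_mem_vtSublevel (params D) (window_strict D) (by norm_num)

/-- **The polytope region DOMINATES the window region of record**: for every `D`, the certified set of the window route
(`Bench/IEEE118SPdEnergyRoa.lean`: `V ≤ 61/100` on the phase-cohesive window `|δᵢ − δⱼ| < π/2`, momentum leaf) is CONTAINED in the
certified set of this file (`V ≤ 23/5` on Vu–Turitsyn's polytope, same leaf): `window ⊆ polytope` (`window_subset_vtPolytope`, the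
equilibrium line angles being below `π/2`) and `61/100 ≤ 23/5`. Same model, same Lyapunov function, same leaf; a containment of certified
SETS (not a statement about any grid). [folklore] -/
theorem window_region_subset_polytope_region (D : Fin 172 → ℝ) :
    {y : (Fin 172 → ℝ) × (Fin 172 → ℝ) |
        y ∈ (params D).window ∩ (params D).constraintSet IEEE118SPd.δ₀ ∧
          (params D).energy IEEE118SPd.δ₀ y.1 y.2 ≤ 61 / 100}
      ⊆ {y | y ∈ vtPolytope (params D) IEEE118SPd.δ₀ ∩ constraintSet (params D) IEEE118SPd.δ₀ ∧
          phaseEnergy (params D) IEEE118SPd.δ₀ y ≤ 23 / 5} := by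
  rintro y ⟨⟨hw, hM⟩, hV⟩
  refine ⟨⟨?_, ?_⟩, ?_⟩
  · have hw' : y ∈ window (params D) := by rwa [(params D).lyapunov_window_eq]
    exact window_subset_vtPolytope (params D) (fun i j hij => (window_strict D i j hij).le) hw'
  · rwa [(params D).lyapunov_constraintSet_eq IEEE118SPd.δ₀]
  · rw [phaseEnergy_apply]
    linarith

end Summit.Ventures.GridStability.Bench.IEEE118SPd

end
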